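import Literature.Probability.Percolation.ArmSeparationHland
import HarnessLib

/-!
# The landing inequality on one rung, with explicit parameters

Topic: Probability / Percolation; family `crit-perc`. A brick of the discharge of
`Literature.Probability.Percolation.Nolin2008_twoArm_separation` (Nolin 2008, Thm. 11
[arXiv 0711.4948: Thm. 10]; `ArmSeparation.lean`), landing step of the internal extremities
(Nolin 2008, §4.4, the constant `C₁(η')`). The parameters of the rung of radius `m` are fixed as
functions of `m` and of two constants `D` (inverse relative size of the smallest fence scale,
`k₀ = m / D`) and `K` (number of fence scales): `rungParams m N D K`. For `D ≥ 256 · 32^K`, `m` odd,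
`m ≥ 64 D`, `m ≥ 257`, `N ≥ 2m`, `K ≥ 1` the rung is valid (`rungParams_valid`), every corridor has
probability at least `c_F c_ρ^(24 D + 11)` with `ρ = 256 · 32^K` (`real_corr_ge`, from
`real_corrEvent_ge`), the number of windows is at most `8 D`
(`Nw_le`), and `real_intTinyExt_le` becomes the landing inequality with a constant depending on
`D, K` only (`exists_hland_const`):
`P(IntTinyExt m N (m/D) K (8 μ)) ≤ C₁(D, K) · P(sepTwoArm ((m-1)/2) N)`.

## References

* P. Nolin, *Near-critical percolation in two dimensions*, Electron. J. Probab. 13 (2008), §4.4,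
  proof of Thm. 11, internal extremities [arXiv 0711.4948: Thm. 10]. [Nolin2008]
-/

noncomputable section

open Set MeasureTheory

namespace Literature.Probability.Percolation

open LatticeModels HalfAnnulus Tube

/-- **The parameters of the rung of radius `m`**: target radius `(m-1)/2`, smallest scale
`k₀ = m / D`, `K` scales, tip margin `R₀ = 8 μ = 8 k₀ 32^K`. [cite: Nolin2008, §4.4 (arXiv 0711.4948: Thm. 10, internal extremities)] -/
def rungParams (m N D K : ℕ) : LParams := ⟨m, (m - 1) / 2, N, m / D, K, 8 * trapScale (m / D) K⟩

/-- **The rung is valid** for `D ≥ 256 · 32^K`, `m` odd, `m ≥ 64 D`, `m ≥ 257`, `N ≥ 2m`. [folklore] -/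
theorem rungParams_valid {m N D K : ℕ} (hD : 256 * 32 ^ K ≤ D) (hm : 64 * D ≤ m) (hodd : m % 2 = 1) (hm' : 257 ≤ m)
    (hN : 2 * m ≤ N) : (rungParams m N D K).Valid := by
  have hD1 : 1 ≤ D := by have h1 : 1 ≤ 32 ^ K := Nat.one_le_pow _ _ (by norm_num); omega
  have hk : 64 ≤ m / D := (Nat.le_div_iff_mul_le (by omega)).2 (by linarith)
  have hμ : 256 * trapScale (m / D) K ≤ m := by
    unfold trapScale
    calc 256 * (m / D * 32 ^ K) = m / D * (256 * 32 ^ K) := by ring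
      _ ≤ m / D * D := Nat.mul_le_mul_left _ hD
      _ ≤ m := Nat.div_mul_le_self m D
  exact
    { hm := by show m = 2 * ((m - 1) / 2) + 1; omega
      hk₀ := hk
      hN := hN
      hn := by show 128 ≤ (m - 1) / 2; omega
      hμn := by show 64 * trapScale (m / D) K ≤ (m - 1) / 2; omega
      hR₀ := by show 8 * trapScale (m / D) K ≤ 8 * trapScale (m / D) K; exact le_rfl
      hR₀n := by show 4 * (8 * trapScale (m / D) K) ≤ (m - 1) / 2; omega }

/-- Chunks per side of the rings: `nB, nW ≤ 2 D` (`k₀ = m / D ≥ 64`... precisely `64 D ≤ m`, `1 ≤ D`). [folklore] -/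
theorem nB_le {m N D K : ℕ} (hD1 : 1 ≤ D) (hm : 64 * D ≤ m) : (rungParams m N D K).nB ≤ 2 * D ∧ (rungParams m N D K).nW ≤ 2 * D := by
  have hk : 64 ≤ m / D := (Nat.le_div_iff_mul_le (by omega)).2 (by linarith)
  have hlt : m < (m / D + 1) * D := (Nat.lt_div_mul_add (a := m) hD1).trans_eq (by ring)
  have key : ∀ r, r ≤ m → r / (m / D) ≤ 2 * D := fun r hr => by
    apply Nat.le_of_lt_succ
    apply Nat.div_lt_of_lt_mul
    calc r ≤ m := hr
      _ < (m / D + 1) * D := hlt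
      _ ≤ m / D * (2 * D + 1) := by nlinarith
  constructor
  · show (m / D) * ((m - trapScale (m / D) K) / (m / D)) / (m / D) ≤ 2 * D
    rw [Nat.mul_div_cancel_left _ (by omega)]
    exact key _ (Nat.sub_le _ _)
  · show (m / D) * ((m - 3 * trapScale (m / D) K) / (m / D)) / (m / D) ≤ 2 * D
    rw [Nat.mul_div_cancel_left _ (by omega)]
    exact key _ (Nat.sub_le _ _)

/-- The number of windows is at most `8 D` (`64 D ≤ m`). [folklore] -/
theorem Nw_le {m N D K : ℕ} (hD1 : 1 ≤ D) (hm : 64 * D ≤ m) : (rungParams m N D K).Nw ≤ 8 * D := by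
  have hk : 64 ≤ m / D := (Nat.le_div_iff_mul_le (by omega)).2 (by linarith)
  have hlt : m < (m / D + 1) * D := (Nat.lt_div_mul_add (a := m) hD1).trans_eq (by ring)
  have hw : 16 ≤ m / D / 4 := by omega
  have hw' : m / D ≤ 4 * (m / D / 4) + 3 := by omega
  show m / (m / D / 4) + 1 ≤ 8 * D
  have : m / (m / D / 4) < 7 * D := by
    apply Nat.div_lt_of_lt_mul
    calc m < (m / D + 1) * D := hlt
      _ ≤ (4 * (m / D / 4) + 4) * D := by nlinarith
      _ ≤ m / D / 4 * (7 * D) := by nlinarith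
  omega

/-- The spoke's aspect condition: `L + k/4 ≤ ρ (2 ε)` with `ρ = 256 · 32^K`, for both spokes
(`L ≤ 3μ + 2s + 4e`, `k ≤ μ / 32`, `k₀ ≥ 64`). [folklore] -/
theorem spoke_aspect {k₀ K L k : ℕ} (hk₀ : 64 ≤ k₀) (hL : L ≤ 3 * trapScale k₀ K + 2 * k₀ + 4 * (k₀ / 4))
    (hk : 32 * k ≤ trapScale k₀ K) : L + k / 4 ≤ 256 * 32 ^ K * (2 * (k₀ / 16)) := by
  unfold trapScale at hL hk
  have hX : 1 ≤ 32 ^ K := Nat.one_le_pow _ _ (by norm_num)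
  have hq : 4 ≤ k₀ / 16 := by omega
  have hε : k₀ ≤ 16 * (k₀ / 16) + 15 := by omega
  have h1 : k / 4 ≤ k := Nat.div_le_self _ _
  have h2 : 4 * (k₀ / 4) ≤ k₀ := Nat.mul_div_le _ _
  have a1 : k ≤ k₀ * 32 ^ K := by linarith
  have a2 : k₀ ≤ k₀ * 32 ^ K := Nat.le_mul_of_pos_right _ hX
  have a3 : L + k / 4 ≤ 7 * (k₀ * 32 ^ K) := by linarith
  have a4 : 7 * (k₀ * 32 ^ K) ≤ 112 * (k₀ / 16 * 32 ^ K) + 105 * 32 ^ K := by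
    have := Nat.mul_le_mul_right (32 ^ K) hε
    nlinarith
  have a5 : 105 * 32 ^ K ≤ 27 * (k₀ / 16 * 32 ^ K) := by
    have := Nat.mul_le_mul_right (32 ^ K) hq
    nlinarith
  nlinarith

/-- The approach tube's aspect condition: `W ≤ ρ (n/64)` (`W + … = r + 2e ≤ m = 2n+1`, `n ≥ 128`, `ρ ≥ 256`). [folklore] -/
theorem approach_aspect {n W ρ : ℕ} (hn : 128 ≤ n) (hW : W ≤ 2 * n + 1) (hρ : 256 ≤ ρ) : W ≤ ρ * (n / 64) := by
  have h1 : n ≤ 64 * (n / 64) + 63 := by omega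
  have h2 : 256 * (n / 64) ≤ ρ * (n / 64) := Nat.mul_le_mul_right _ hρ
  omega

/-- **The corridors of every slot have probability at least `c_F c^(24 D + 11)`** on a valid rung
(`ρ = 256 · 32^K`). [cite: Nolin2008, §4.3 Prop. 12 (proof) (arXiv 0711.4948: Prop. 11)] -/
theorem real_corr_ge {cF c : ℝ} {m N D K : ℕ} (hF : ∀ (z : Site 2) (k : ℕ), 1 ≤ k → cF ≤ (triSitePercolation half).real (triFrameAt z k))
    (hcF : 0 ≤ cF)
    (hrsw : ∀ q : ℕ, 1 ≤ ⌊((256 * 32 ^ K : ℕ) : ℝ) * q⌋₊ → c ≤ triLRCrossingProb half ⌊((256 * 32 ^ K : ℕ) : ℝ) * q⌋₊ q) (hc : 0 ≤ c)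
    (hD : 256 * 32 ^ K ≤ D) (hm : 64 * D ≤ m) (hodd : m % 2 = 1) (hm' : 257 ≤ m) (hN : 2 * m ≤ N)
    {σ : Slot} (hσ : σ.InRange (rungParams m N D K)) :
    cF * c ^ (24 * D + 11) ≤ (triSitePercolation half).real (σ.blackCorr (rungParams m N D K)) ∧
      cF * c ^ (24 * D + 11) ≤ (triSitePercolation half).real (σ.whiteCorr (rungParams m N D K)) := by
  set P := rungParams m N D K with hP
  have hV : P.Valid := rungParams_valid hD hm hodd hm' hN
  obtain ⟨hs, hw, he, hε, hk₀, hkμ, hrB, hrB', hrW, hrW', hnB, hnW, hmn, hN2, hn, hμn, hR₀, hR₀n⟩ := hV.facts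
  have hX : 1 ≤ 32 ^ K := Nat.one_le_pow _ _ (by norm_num)
  have hρ32 : 32 ≤ 256 * 32 ^ K := by clear * - hX; omega
  have hρ4 : 4 ≤ 256 * 32 ^ K := by clear * - hX; omega
  have hρ1 : 1 ≤ 256 * 32 ^ K := by clear * - hX; omega
  have hc1 : c ≤ 1 := by
    have h := hrsw 1 (by rw [Nat.cast_one, mul_one, Nat.floor_natCast]; exact hρ1)
    exact h.trans measureReal_le_one
  have hko1 : P.k₀ ≤ σ.ko P := le_trapScale _ _
  have hko2 : 32 * σ.ko P ≤ P.μ := P.scale_le hσ.hjo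
  have hkc1 : P.k₀ ≤ σ.kc P := le_trapScale _ _
  have hkc2 : 32 * σ.kc P ≤ P.μ := P.scale_le hσ.hjc
  have hD1 : 1 ≤ D := by clear * - hD hX; omega
  obtain ⟨hnB2, hnW2⟩ := nB_le (N := N) (K := K) hD1 hm
  rw [← hP] at hnB2 hnW2
  have hk₀D : P.k₀ = m / D := rfl
  have hμdef : P.μ = trapScale P.k₀ K := rfl
  -- small arithmetic side conditions
  have a1 : 2 ≤ σ.ko P := by clear * - hk₀ hko1; omega
  have a1' : 2 ≤ σ.kc P := by clear * - hk₀ hkc1; omega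
  have a2 : 1 ≤ P.ε := by rw [hε]; clear * - hk₀; omega
  have a3 : 1 ≤ P.e := by rw [he]; clear * - hk₀; omega
  have a4 : P.s + 2 * P.e ≤ 4 * (2 * P.e) := by rw [hs, he]; clear * - hk₀; omega
  have a5 : 1 ≤ P.n / 64 := by clear * - hn; omega
  have a6 : 2 * (P.n / 64) ≤ P.n / 8 - 2 := by clear * - hn; omega
  have a7 : 1 ≤ P.n / 8 - 2 := by clear * - hn; omega
  have hlenB : (arc (thinRing P.rB P.e P.s) (σ.aB P) P.lenB).length ≤ P.lenB := List.length_take_le _ _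
  have hlenW : (arc (thinRing P.rW P.e P.s) (σ.aW P) (σ.lenW P)).length ≤ σ.lenW P := List.length_take_le _ _
  have hexpB : P.lenB + 3 ≤ 24 * D + 11 := by unfold LParams.lenB; clear * - hnB2; omega
  have hexpW : σ.lenW P + 3 ≤ 24 * D + 11 := by unfold Slot.lenW; clear * - hnW2; omega
  have hWB : P.WB ≤ 2 * P.n + 1 := by unfold LParams.WB; clear * - hrB hmn he hkμ hk₀ hn hμn; omega
  have hWW : P.WW ≤ 2 * P.n + 1 := by unfold LParams.WW; clear * - hrW hmn he hkμ hk₀ hn hμn; omega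
  have hLB : P.LB ≤ 3 * trapScale P.k₀ K + 2 * P.k₀ + 4 * (P.k₀ / 4) := by
    unfold LParams.LB; rw [hs, he, ← hμdef]; clear * - hk₀; omega
  have hLW : P.LW ≤ 3 * trapScale P.k₀ K + 2 * P.k₀ + 4 * (P.k₀ / 4) := by
    unfold LParams.LW; rw [hs, he, ← hμdef]
  have hspB : P.LB + σ.ko P / 4 ≤ 256 * 32 ^ K * (2 * P.ε) := by
    rw [hε]; exact spoke_aspect (K := K) hk₀ hLB (by rw [← hμdef]; exact hko2)
  have hspW : P.LW + σ.kc P / 4 ≤ 256 * 32 ^ K * (2 * P.ε) := by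
    rw [hε]; exact spoke_aspect (K := K) hk₀ hLW (by rw [← hμdef]; exact hkc2)
  have happB : P.WB ≤ 256 * 32 ^ K * (P.n / 64) := approach_aspect hn hWB (by clear * - hX; omega)
  have happW : P.WW ≤ 256 * 32 ^ K * (P.n / 64) := approach_aspect hn hWW (by clear * - hX; omega)
  constructor
  · have h := real_corrEvent_ge (i := σ.io) (m := P.m) (n := P.n) (k := σ.ko P) (T₀ := σ.To P) (w := P.w) (L := P.LB) (ε := P.ε)
      (r := P.rB) (e := P.e) (s := P.s) (a := σ.aB P) (len := P.lenB) (t := σ.tgo P) (W := P.WB) hF hrsw hρ4 hc a1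
      a2 hspB a3 a4 a5 happB a6 a7 hlenB
    refine le_trans ?_ h
    exact mul_le_mul_of_nonneg_left (pow_le_pow_of_le_one hc hc1 hexpB) hcF
  · rw [Slot.real_whiteCorr_eq]
    have h := real_corrEvent_ge (i := σ.ic') (m := P.m) (n := P.n) (k := σ.kc P) (T₀ := σ.Tc P) (w := P.w) (L := P.LW) (ε := P.ε)
      (r := P.rW) (e := P.e) (s := P.s) (a := σ.aW P) (len := σ.lenW P) (t := σ.tgc P) (W := P.WW) hF hrsw hρ4 hc a1'
      a2 hspW a3 a4 a5 happW a6 a7 hlenW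
    refine le_trans ?_ h
    exact mul_le_mul_of_nonneg_left (pow_le_pow_of_le_one hc hc1 hexpW) hcF

/-- **The landing inequality on one rung with a constant depending on `D, K` only** (Nolin's
`C₁(η')`): for `D ≥ 256 · 32^K` there is `C₁` with
`P(IntTinyExt m N (m/D) K (8 μ)) ≤ C₁ · P(sepTwoArm ((m-1)/2) N)` for all odd `m ≥ max(64 D, 257)`
and `N ≥ 2m`. [cite: Nolin2008, §4.4, proof of Thm. 11, internal extremities (arXiv 0711.4948: Thm. 10, the constant `C₁(η')`)] -/
theorem exists_hland_const (D K : ℕ) (hK : 1 ≤ K) (hD : 256 * 32 ^ K ≤ D) :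
    ∃ C₁ : ℝ, 0 ≤ C₁ ∧ ∀ m N : ℕ, 64 * D ≤ m → m % 2 = 1 → 257 ≤ m → 2 * m ≤ N →
      (triSitePercolation half).real (IntTinyExt m N (m / D) K (8 * trapScale (m / D) K)) ≤
        C₁ * (triSitePercolation half).real (sepTwoArm ((m - 1) / 2) N) := by
  obtain ⟨cF, hcF, hF⟩ := exists_pos_le_real_triFrameAt
  obtain ⟨c, hc, hrsw⟩ := tri_rsw_half_holds ((256 * 32 ^ K : ℕ) : ℝ) (by positivity)
  set cc : ℝ := cF * c ^ (24 * D + 11) with hcc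
  have hcc0 : 0 < cc := by positivity
  refine ⟨((6 * K * (8 * D)) ^ 2 : ℕ) / (cc * cc), by positivity, fun m N hm hodd hm' hN => ?_⟩
  set P := rungParams m N D K with hP
  have hV : P.Valid := rungParams_valid hD hm hodd hm' hN
  have hrsw' : ∀ q : ℕ, 1 ≤ ⌊((256 * 32 ^ K : ℕ) : ℝ) * q⌋₊ → c ≤ triLRCrossingProb half ⌊((256 * 32 ^ K : ℕ) : ℝ) * q⌋₊ q :=
    fun q hq => (hrsw q hq).1
  have key := real_intTinyExt_le hV hK hcc0 hcc0
    (fun σ hσ => (real_corr_ge hF hcF.le hrsw' hc.le hD hm hodd hm' hN (σ := σ) (by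
      obtain ⟨h1, h2, h3, h4, h5, h6⟩ := mem_slotFinset.1 hσ; exact ⟨h1, h2, h4, h5⟩)).1)
    (fun σ hσ => (real_corr_ge hF hcF.le hrsw' hc.le hD hm hodd hm' hN (σ := σ) (by
      obtain ⟨h1, h2, h3, h4, h5, h6⟩ := mem_slotFinset.1 hσ; exact ⟨h1, h2, h4, h5⟩)).2)
  have hXK : 1 ≤ 32 ^ K := Nat.one_le_pow _ _ (by norm_num)
  have hNw := Nw_le (N := N) (K := K) (by clear * - hD hXK; omega) hm
  rw [← hP] at hNw
  refine key.trans ?_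
  have hnn : 0 ≤ (triSitePercolation half).real (sepTwoArm P.n P.N) / (cc * cc) := div_nonneg measureReal_nonneg (by positivity)
  calc (((6 * P.K * P.Nw) ^ 2 : ℕ) : ℝ) * ((triSitePercolation half).real (sepTwoArm P.n P.N) / (cc * cc))
      ≤ (((6 * K * (8 * D)) ^ 2 : ℕ) : ℝ) * ((triSitePercolation half).real (sepTwoArm P.n P.N) / (cc * cc)) := by
        apply mul_le_mul_of_nonneg_right _ hnn
        exact_mod_cast Nat.pow_le_pow_left (Nat.mul_le_mul_left _ hNw) 2
    _ = ((6 * K * (8 * D)) ^ 2 : ℕ) / (cc * cc) * (triSitePercolation half).real (sepTwoArm ((m - 1) / 2) N) := by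
        rw [show P.n = (m - 1) / 2 from rfl, show P.N = N from rfl]; ring

end Literature.Probability.Percolation
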